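import Summits.Ventures.GridStability.Bench.NE39SPLoadStepG1A
import Summits.Ventures.GridStability.Bench.NE39SPLoadStepG1B
import Summits.Ventures.GridStability.Bench.NE39SPLoadStepG1C
import Summits.Ventures.GridStability.Bench.NE39SPLoadStepG1D
import Summits.Ventures.GridStability.Bench.NE39SPLoadStepG1E
import Summits.Ventures.GridStability.Bench.NE39SPLoadStepG1F
import Summits.Ventures.GridStability.Bench.NE39SPLoadStepG1G
import Summits.Ventures.GridStability.Bench.NE39SPLoadStepG1H
import Summits.Ventures.GridStability.Bench.NE39SPStepAll
import HarnessLib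

/-!
# GridStability/Bench/NE39SPLoadStepG1All — uniform sentence of the G1 table (version-R certificates): «+5 pu sudden
# load pickup at ANY of the 39 network buses of the STRUCTURE-PRESERVING New England instance, supplied by the
# ORDINARY unit G1 (node 39, H ≈ 30 s)» re-synchronises from the pre-step synchronous state (39/39), with the
# transient machine-speed bound

Cell `gridfusion` (LADDER-GRIDFUSION), seat gridfusion-lyap-1 (g9), line «G2.b-NE39SP-LOADSTEP» (G1 table). INSTANCE OF
RECORD BY NAME: model-2's `Models/NE39SP.lean` ([cite: Padiyar2013, App. D]); per-bus v2 certificates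
`stepG1certNN`/`stepG1checkNN`/`stepG1NN_resync` (`Bench/NE39SPLoadStepG1A…H.lean`); `Pstep`, `paramsStep`, `P0Q`,
`loadBusNodes` (`Bench/NE39SPStepDefs.lean`, `…StepAll.lean`); `stepR_resync_NE39SP` (`Bench/NE39SPStepR.lean`);
`speed_le_of_energy_le` (`Bench/NE39SPLineSwitchAll.lean`). NO NEW CERTIFICATE DATA.

WHY A SECOND TABLE: with the supplying machine an ordinary 30-s unit instead of the 500-s external equivalent, G1's
internal angle after the step is ≈ 36° — beyond the ≈ 32.5° reach of the v1 uniform level `2cos γ − 3.141593 sin γ`;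
the version-R certificates use the per-edge enclosure-robust Vu–Turitsyn level `ratGapR` (kernel level ≥ 7.80 here)
[cite: VuTuritsyn2016, Appendix 9.3]. THREE COLUMNS. CERTIFIED (kernel): `exists_stepG1cert` (39/39: `R = 10⁻⁶`,
`c ≤ 243 / 100`, `checkR` passed); **`loadstep5_G1_resync`** (uniform sentence ∀ b ∈ loadBusNodes ∀ D > 0: existence of the
post-step synchronous state, coupled branches inside `2·arctan τγ ≈ 36.6°`, and re-synchronisation of every solution
from the pre-step synchronous state inside the VT polytope with `V ≤ c`); **`loadstep5_G1_speed_bound`**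
(`|δ̇ⱼ(t)| ≤ √(2c/Mⱼ)`). MODELLED: as ★ #150 with «supplied by G1's mechanical power (no governor/AGC); 5 pu declared
stress datum». VALIDATED: nothing (floats: node shifts up to ≈ 51°, worst bus 9). No sentence here says the New England
system is stable. No new definition; no named fact; standard axioms.
-/

noncomputable section

open Set Filter Topology Real Finset
open Summit.Ventures.GridStability.Models
open Summit.Ventures.GridStability.Models.StructurePreserving
open Summit.Ventures.GridStability.Models.NE39SP
open Summit.Ventures.GridStability.Lyapunov.StructurePreserving
open Summit.Ventures.GridStability.Lyapunov.StructurePreserving.Switch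

namespace Summit.Ventures.GridStability.Bench.NE39SP

/-- **39/39 (G1 table)**: every network bus carries a version-R certificate (`R = 10⁻⁶`, `c ≤ 243 / 100`) passing
`Cert.checkR` against `Pstep b 39 5`. CERTIFIED column. [folklore] -/
theorem exists_stepG1cert : ∀ b ∈ loadBusNodes, ∃ C : Cert 49 56,
    C.R = 1 / 1000000 ∧ C.c ≤ 243 / 100 ∧
      C.checkR NE39SP.srcV NE39SP.tgtV NE39SP.wtLFQ (Pstep b 39 5) NE39SP.tLFQ 39 := by
  intro b hb
  fin_cases hb
  exacts [⟨stepG1cert01, rfl, by decide +kernel, stepG1check01⟩,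
    ⟨stepG1cert02, rfl, by decide +kernel, stepG1check02⟩,
    ⟨stepG1cert03, rfl, by decide +kernel, stepG1check03⟩,
    ⟨stepG1cert04, rfl, by decide +kernel, stepG1check04⟩,
    ⟨stepG1cert05, rfl, by decide +kernel, stepG1check05⟩,
    ⟨stepG1cert06, rfl, by decide +kernel, stepG1check06⟩,
    ⟨stepG1cert07, rfl, by decide +kernel, stepG1check07⟩,
    ⟨stepG1cert08, rfl, by decide +kernel, stepG1check08⟩,
    ⟨stepG1cert09, rfl, by decide +kernel, stepG1check09⟩,
    ⟨stepG1cert10, rfl, by decide +kernel, stepG1check10⟩,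
    ⟨stepG1cert11, rfl, by decide +kernel, stepG1check11⟩,
    ⟨stepG1cert12, rfl, by decide +kernel, stepG1check12⟩,
    ⟨stepG1cert13, rfl, by decide +kernel, stepG1check13⟩,
    ⟨stepG1cert14, rfl, by decide +kernel, stepG1check14⟩,
    ⟨stepG1cert15, rfl, by decide +kernel, stepG1check15⟩,
    ⟨stepG1cert16, rfl, by decide +kernel, stepG1check16⟩,
    ⟨stepG1cert17, rfl, by decide +kernel, stepG1check17⟩,
    ⟨stepG1cert18, rfl, by decide +kernel, stepG1check18⟩,
    ⟨stepG1cert19, rfl, by decide +kernel, stepG1check19⟩,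
    ⟨stepG1cert20, rfl, by decide +kernel, stepG1check20⟩,
    ⟨stepG1cert21, rfl, by decide +kernel, stepG1check21⟩,
    ⟨stepG1cert22, rfl, by decide +kernel, stepG1check22⟩,
    ⟨stepG1cert23, rfl, by decide +kernel, stepG1check23⟩,
    ⟨stepG1cert24, rfl, by decide +kernel, stepG1check24⟩,
    ⟨stepG1cert25, rfl, by decide +kernel, stepG1check25⟩,
    ⟨stepG1cert26, rfl, by decide +kernel, stepG1check26⟩,
    ⟨stepG1cert27, rfl, by decide +kernel, stepG1check27⟩,
    ⟨stepG1cert28, rfl, by decide +kernel, stepG1check28⟩,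
    ⟨stepG1cert29, rfl, by decide +kernel, stepG1check29⟩,
    ⟨stepG1cert30, rfl, by decide +kernel, stepG1check30⟩,
    ⟨stepG1cert31, rfl, by decide +kernel, stepG1check31⟩,
    ⟨stepG1cert32, rfl, by decide +kernel, stepG1check32⟩,
    ⟨stepG1cert33, rfl, by decide +kernel, stepG1check33⟩,
    ⟨stepG1cert34, rfl, by decide +kernel, stepG1check34⟩,
    ⟨stepG1cert35, rfl, by decide +kernel, stepG1check35⟩,
    ⟨stepG1cert36, rfl, by decide +kernel, stepG1check36⟩,
    ⟨stepG1cert37, rfl, by decide +kernel, stepG1check37⟩,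
    ⟨stepG1cert38, rfl, by decide +kernel, stepG1check38⟩,
    ⟨stepG1cert39, rfl, by decide +kernel, stepG1check39⟩]

/-- **THE UNIFORM LOAD-PICKUP SENTENCE, G1 TABLE (39/39), MODEL MV-3, New England SP column LF.** For EVERY network bus
node `b` and EVERY `D > 0`: certificate data `C` (`R = 10⁻⁶`, `c ≤ 243 / 100`, `checkR` passed) and a synchronous angle
vector `θ` of `paramsStep b 39 5 D` (+5 pu at `b` supplied by G1 at `t = 0`) exist — all 49 power-flow equations
exactly, `θ` within `10⁻⁶` rad of `halfAngle C.t1`, coupled branches inside `2·arctan C.τγ` — and EVERY solution from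
the PRE-step synchronous state keeps Vu–Turitsyn's polytope and `V(θ; ·) ≤ c` for all `t ≥ 0`, converges to
`θ + κ·1` and has machine speeds `→ 0`. No sentence here says the New England system is stable.
[cite: VuTuritsyn2016, §IV, §VI, Appendix 9.3; Padiyar2013, App. D] -/
theorem loadstep5_G1_resync (b : Fin 49) (hb : b ∈ loadBusNodes) (D : Fin 49 → ℝ) (hD : ∀ j, 0 < D j) :
    ∃ C : Cert 49 56, C.R = 1 / 1000000 ∧ C.c ≤ 243 / 100 ∧
      C.checkR NE39SP.srcV NE39SP.tgtV NE39SP.wtLFQ (Pstep b 39 5) NE39SP.tLFQ 39 ∧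
      ∃ θ : Fin 49 → ℝ,
        θ 39 = halfAngle (fun j => (C.t1 j : ℝ)) 39 ∧
        (∀ j, |θ j - halfAngle (fun j => (C.t1 j : ℝ)) j| < (C.R : ℝ)) ∧
        (∀ j, (paramsStep b 39 5 D).pe θ j = (paramsStep b 39 5 D).P0 j) ∧
        (∀ a c, a ≠ c → (paramsStep b 39 5 D).b a c ≠ 0 → |θ a - θ c| < 2 * Real.arctan (C.τγ : ℝ)) ∧
        ∀ δ : ℝ → Fin 49 → ℝ, (paramsStep b 39 5 D).IsSolution δ → δ 0 = NE39SP.δ₀ →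
          (∀ j ∈ NE39SP.genS, deriv (fun u => δ u j) 0 = 0) →
          (∀ t, 0 ≤ t →
              (∀ a c, (paramsStep b 39 5 D).b a c ≠ 0 → |(δ t a - δ t c) + (θ a - θ c)| < π) ∧
                (paramsStep b 39 5 D).energy θ (δ t) (fun j => deriv (fun u => δ u j) t) ≤ (C.c : ℝ)) ∧
            Tendsto δ atTop (𝓝 fun j => θ j + (∑ k, D k * (NE39SP.δ₀ k - θ k)) / ∑ k, D k) ∧
            ∀ j ∈ NE39SP.genS, Tendsto (fun t => deriv (fun u => δ u j) t) atTop (𝓝 0) := by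
  obtain ⟨C, hR, hc, hchk⟩ := exists_stepG1cert b hb
  exact ⟨C, hR, hc, hchk, stepR_resync_NE39SP hchk D hD⟩

/-- **G1-table transient machine-speed bound.** Along every solution of `loadstep5_G1_resync`'s situation,
`|δ̇ⱼ(t)| ≤ √(2c/Mⱼ)` at every machine for all `t ≥ 0` (`c ≤ 243 / 100`). [cite: VuTuritsyn2016, §IV; Padiyar2013, §3.2 eq (3.11)] -/
theorem loadstep5_G1_speed_bound (b : Fin 49) (hb : b ∈ loadBusNodes) (D : Fin 49 → ℝ) (hD : ∀ j, 0 < D j) :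
    ∃ C : Cert 49 56, C.c ≤ 243 / 100 ∧ C.checkR NE39SP.srcV NE39SP.tgtV NE39SP.wtLFQ (Pstep b 39 5) NE39SP.tLFQ 39 ∧
      ∃ θ : Fin 49 → ℝ, (∀ j, (paramsStep b 39 5 D).pe θ j = (paramsStep b 39 5 D).P0 j) ∧
        ∀ δ : ℝ → Fin 49 → ℝ, (paramsStep b 39 5 D).IsSolution δ → δ 0 = NE39SP.δ₀ →
          (∀ j ∈ NE39SP.genS, deriv (fun u => δ u j) 0 = 0) →
          ∀ t, 0 ≤ t → ∀ j ∈ NE39SP.genS,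
            |deriv (fun u => δ u j) t| ≤ Real.sqrt (2 * (C.c : ℝ) / (NE39SP.MQ j : ℝ)) := by
  obtain ⟨C, -, hc, hchk, θ, -, -, heq, hcoh, hdyn⟩ := loadstep5_G1_resync b hb D hD
  refine ⟨C, hc, hchk, θ, heq, fun δ hδ hδ0 hv0 t ht j hj => ?_⟩
  obtain ⟨hstay, -, -⟩ := hdyn δ hδ hδ0 hv0
  obtain ⟨hpol, hV⟩ := hstay t ht
  have hτ1 : (C.τγ : ℝ) < 1 := by exact_mod_cast hchk.1.2.2.2.2.1
  have hbnn : ∀ a c, 0 ≤ (paramsStep b 39 5 D).b a c := fun a c => by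
    rw [paramsStep_b]
    exact symmetrize_nonneg (edgeWeight_nonneg fun e => by exact_mod_cast (hchk.2.1 e).1) a c
  have h0 : ∀ a c, (paramsStep b 39 5 D).b a c ≠ 0 → |θ a - θ c| ≤ π / 2 := by
    intro a c hac
    by_cases h : a = c
    · subst h
      rw [sub_self, abs_zero]
      positivity
    · exact ((hcoh a c h hac).trans (two_mul_arctan_lt_pi_div_two hτ1)).le
  have := speed_le_of_energy_le (paramsStep_wellFormed b 39 5 hD) hbnn h0
    (fun a c hac => (hpol a c hac).le) hV j hj
  have hM : (paramsStep b 39 5 D).M j = (NE39SP.MQ j : ℝ) := rfl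
  rw [hM] at this
  exact this

end Summit.Ventures.GridStability.Bench.NE39SP

end
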